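import Literature.NumberTheory.DiophantineGeometry.MultiplicativeGroupApproximationOfMatveevYu
import Literature.NumberTheory.DiophantineGeometry.PastenSubexpGenerators
import Literature.Barriers.ABC.BakerMethodBoundsStewartTijdemanGenericProofs
import HarnessLib

/-!
# Yu 2007, *p-adic logarithmic forms and group varieties III*: the consequences of the Main
# Theorem over `ℚ` that the tree did not yet carry, and their PRIMES-ONLY forms

Topic `NumberTheory/DiophantineGeometry`; namespace `Literature.NumberTheory.DiophantineGeometry.Dioph`
(siblings: `MultiplicativeGroupApproximationOfMatveevYu` — Matveev 2000 Cor. 2.3 over `ℚ`;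
`StewartYuPadicLogForms` — Yu 2013 / Stewart 2013; the fact of record for Yu 2007 over `ℚ` is
`Literature.Barriers.ABC.yu2007_padicLogForm_rat` = Evertse–Győry 2015 Thm. 3.2.7 = the "second
consequence" / "Corollary of Theorem 4" of Yu 2007, which this file does NOT restate).

K. Yu, *p-adic logarithmic forms and group varieties III*, Forum Math. 19 (2007) 187–280 is
paywalled and not held (acquisition `acq-02484`, cite-only since 2026-08-25; no preprint exists in
any corpus searched: MPIM, HKUST, arXiv, galaxy panama/pdf/crabby; the zbMATH review Zbl 1132.11038
carries no formula). The statements below are therefore typed from HELD SECONDARY SOURCES that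
restate them with all constants, and each docstring says which:

* `yu2007_padicLogForm_units_rat` — the `℘`-ADIC-UNITS form of Yu's theorem (sharper in `n` and
  `d` than Thm. 3.2.7 when the `αⱼ` are `℘`-adic units and `α₁,…,α_{n−1}` are multiplicatively
  independent): Győry–Yu, *Bounds for the solutions of S-unit equations and decomposable form
  equations*, Acta Arith. 123 (2006) 9–41, **Proposition 7 (p. 23)** ("This is again a consequence
  of Theorem 4 in [33]" = Yu 2007; Yu is a co-author), held open-access (`paper:url-0f17803063b3`,
  chunk p0015), case `K = ℚ` (`d = 1`, `e_℘ = f_℘ = 1`, `N(℘) = p`). This is the statement in the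
  currency of the cell's `p`-adic ENGINE texts (rational `p`-adic units, multiplicatively
  independent generators): constant `c · aⁿ · n^{3/2} · log(2n) · log 2` with
  `(c, a) = (1692, 48e²)` for `p > 2` and `(292, 128e²)` for `p = 2` — no `nⁿ`, `p/(log p)²`,
  `p`-independent height floor `1/(8e²)` on `αₙ` only.
* `yu2007_padicLogForm_logB_rat` — the `log B` form ("consequence of the Main Theorem on p. 190"
  of Yu 2007), case `K = ℚ`: `ord_p Λ < C · p/(log p)² · ∏ h'(αᵢ) · log B`, `B ≥ max{|bᵢ|, 3}`,
  `h' = max{h, 1/(16e²)}`. Restated by three independent secondaries: Bérczes–Evertse–Győry 2013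
  (arXiv:1301.7168, proof of Prop. 3.10: exponent `n^{3/2}`), Cai 2022 (arXiv:1910.10405, Thm. 3.3:
  `n^{5/2}`), Scoones, PhD thesis York 2023 (Lemma 3.1.0.3: `n^{5/2}`). The three agree on every
  feature (`(16ed)^{2(n+1)}`, `log(2nd) log(2d)`, `e_℘ⁿ N℘/(log N℘)²`, `h'`, `B ≥ 3`, plain `log B`)
  except the power of `n`; we type the WEAKER reading `n^{5/2}` (implied by either), and record the
  discrepancy here. FAITHFULNESS: WEAKER-OR-EQUAL to print.

PROVED here (no further facts): the PRIMES-ONLY forms — `αᵢ` = distinct rational primes `q ∈ S`,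
so `h(q) = log q` swallows both floors (`log 2 > 1/(8e²)`), distinct primes are multiplicatively
independent and are `p`-adic units for `p ∉ S` — in the prime-text currency of the cell
`abc-stewartyu` (`∏_{q∈S} q^{e_q} − 1`, `e : ℕ → ℤ`, `B ≥ max(3, |e_q|)`; compare the route texts
`Y07Odd`/`Y07Two` of `Summits/ABC/ABC/Theses/PadicPrimesKummerThird.lean` and
`Summit.ABC.StewartYu.Y07.y07_of_padicClause`):
`yu2007_padicLogForm_logB_primes` (from the `log B` fact) and `yu2007_padicLogForm_units_primes`
(from the units fact). The `#S = 1` case is outside both facts (`n ≥ 2` in print) and is elementary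
(`Summit.ABC.StewartYu.y07_card_one`).

WHAT THIS IS NOT: not Yu's Main Theorem / Theorem 4 itself (its hypotheses — the Kummer condition
`[K(α₀^{1/q},…,αₙ^{1/q}) : K] = q^{n+1}`, the weighted `h⁽⁰⁾`-heights — are printed only in the
cite-only text and are not restated by any held source); the number-field generality (`K` of
degree `d`, `℘ ∣ p`, `e_℘`, `f_℘`) is NOT typed here but in the sibling
`Yu2007PadicLogFormsNumberField.lean` (`yu2007_padicLogForm_nf`, `yu2007_padicLogForm_logB_nf`,
`yu2007_padicLogForm_units_nf` = Győry–Yu 2006 Prop. 7, each with the `K = ℚ` specialisation PROVED: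
`…_rat_of_nf`), which resolves this file's former `TODO(general form)`; no `p`-adic estimate is
proved here; typed ≠ proved ≠ endorsed.

## References

* [Yu2007] K. Yu, p-adic logarithmic forms and group varieties III, Forum Math. 19 (2007) 187–280:
  Main Theorem; "consequence … on p. 190" (log B form); Theorem 4 and its Corollary (δ-forms).
* [GyoryYu2006] K. Győry, K. Yu, Acta Arith. 123 (2006) 9–41: Prop. 6 (p. 22–23) = Corollary of
  Yu 2007 Thm. 4 (= [EvertseGyory2015] Thm. 3.2.7); Prop. 7 (p. 23) = the `℘`-adic-units form.
* [BerczesEvertseGyory2013] Prop. 3.10 (proof); [Cai2022] Thm. 3.3; [ScoonesThesis2023] Lemma 3.1.0.3: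
  the log B form with constants.
* [EvertseGyory2015] Thm. 3.2.7 (p. 62): the fact of record `yu2007_padicLogForm_rat` (not restated).
-/

open Height Real Finset

noncomputable section

namespace Literature.NumberTheory.DiophantineGeometry.Dioph

/-! ### The two typed consequences over `ℚ` -/

/-- NAMED FACT — **Yu 2007 for `p`-adic units over `ℚ`** (Győry–Yu 2006, Prop. 7, case `K = ℚ`:
`d = 1`, `℘ = p`, `e_℘ = f_℘ = 1`, `N(℘) = p`; "a consequence of Theorem 4 in [Yu 2007]").
For `α₁,…,αₙ ∈ ℚ*` (`n ≥ 2`, indexed by a finite type `κ`, distinguished index `k₀` playing the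
rôle of `n`) that are `p`-adic units (`ord_p αₖ = 0`), with `(αₖ)_{k ≠ k₀}` multiplicatively
independent; `b ∈ ℤⁿ` with `b_{k₀} ≠ 0` and `ord_p b_{k₀} ≤ ord_p bₖ` whenever `bₖ ≠ 0` (the printed
`ord_p bₙ ≤ ord_p bⱼ, j = 1,…,n`, with `ord_p 0 = ∞`); reals `B ≥ max |bₖ|`, `B ≥ Bₙ ≥ |b_{k₀}|`;
`h''_{k₀} = max{h(α_{k₀}), 1/(8e²)}`; `Λ = ∏ αₖ^{bₖ} − 1 ≠ 0`; any `0 < δ ≤ ½`. Then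
`ord_p Λ < c'₂₃(n,1) · p/(log p)² · max{ (∏_{k≠k₀} h(αₖ)) · h''_{k₀} · log M', δB/(Bₙ c'₂₄(n,1)) }`
with `c'₂₃(n,1) = c · aⁿ · n^{3/2} · log(2n) · log 2`, `(c, a) = (1692, 48e²)` if `p > 2`,
`(292, 128e²)` if `p = 2`; `c'₂₄(n,1) = 2^{n+1} log 2 (log 3)³`;
`M' = (Bₙ/δ) · c'₂₅(n,1) · p^{n+1} · ∏_{k≠k₀} h(αₖ)`, `c'₂₅(n,1) = 2e^{(n+1)(6n+5)} log 2`.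
Heights are Mathlib's `Height.logHeight₁` on `ℚ` (absolute logarithmic Weil height). Primary text
(Yu 2007, Thm. 4) cite-only (`acq-02484`); statement read on the held Győry–Yu 2006, p. 23.
Users take `(h : yu2007_padicLogForm_units_rat)`.
[cite: GyoryYu2006, Proposition 7 (p. 23)] [cite: Yu2007, Theorem 4 (consequence)] -/
def yu2007_padicLogForm_units_rat : Prop :=
  ∀ (κ : Type) [Fintype κ] [DecidableEq κ], 2 ≤ Fintype.card κ →
    ∀ (α : κ → ℚ) (b : κ → ℤ) (k₀ : κ) (B Bn δ : ℝ) (p : ℕ), p.Prime →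
      (∀ k, α k ≠ 0 ∧ padicValRat p (α k) = 0) →
      (∀ μ : κ → ℤ, μ k₀ = 0 → ∏ k, α k ^ μ k = 1 → μ = 0) →
      b k₀ ≠ 0 → (∀ k, b k ≠ 0 → padicValInt p (b k₀) ≤ padicValInt p (b k)) →
      (∀ k, (|b k| : ℝ) ≤ B) → Bn ≤ B → (|b k₀| : ℝ) ≤ Bn →
      ∏ k, α k ^ b k - 1 ≠ 0 → 0 < δ → δ ≤ 1 / 2 →
      (padicValRat p (∏ k, α k ^ b k - 1) : ℝ) <
        (if p = 2 then (292 : ℝ) else 1692) *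
            (if p = 2 then 128 * Real.exp 1 ^ 2 else 48 * Real.exp 1 ^ 2) ^ Fintype.card κ *
            (Fintype.card κ : ℝ) ^ (3 / 2 : ℝ) * Real.log (2 * Fintype.card κ) * Real.log 2 *
          (p / Real.log p ^ 2) *
          max ((∏ k ∈ univ.erase k₀, logHeight₁ (α k)) *
                max (logHeight₁ (α k₀)) (1 / (8 * Real.exp 1 ^ 2)) *
                Real.log (Bn / δ * (2 * Real.exp 1 ^ ((Fintype.card κ + 1) *
                    (6 * Fintype.card κ + 5)) * Real.log 2) * (p : ℝ) ^ (Fintype.card κ + 1) *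
                  ∏ k ∈ univ.erase k₀, logHeight₁ (α k)))
            (δ * B / (Bn * (2 ^ (Fintype.card κ + 1) * Real.log 2 * Real.log 3 ^ 3)))

/-- NAMED FACT — **Yu 2007, the `log B` consequence of the Main Theorem (p. 190), case `K = ℚ`**
(`d = 1`, `℘ = p`, `e_℘ = f_℘ = 1`, `N(℘) = p`). For `α₁,…,αₙ ∈ ℚ*` (`n ≥ 2`, indexed by a finite
type `κ`), `b ∈ ℤⁿ`, a real `B ≥ max{|b₁|,…,|bₙ|, 3}`, `h'ₖ = max{h(αₖ), 1/(16e²)}` and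
`Λ = ∏ αₖ^{bₖ} − 1 ≠ 0`:
`ord_p Λ < (16e)^{2(n+1)} · n^{5/2} · log(2n) · log 2 · p/(log p)² · h'₁⋯h'ₙ · log B`.
Primary text cite-only (`acq-02484`); restated with constants by [BerczesEvertseGyory2013]
(proof of Prop. 3.10, arXiv p. 7: "(16ed)^{2n+2} n^{3/2} log(2nd) log(2d) e_℘ⁿ N℘/(log N℘)² Θ log B",
`Θ = ∏ max(h(αᵢ), m(d)) ≥ ∏ h'ᵢ`, `B = max(3,|bᵢ|)`), [Cai2022] Thm. 3.3 (`n^{5/2}`,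
`log Aᵢ = max{h(αᵢ), 1/(16e²d²)}`, `B₀ = max{3,|bᵢ|}`) and [ScoonesThesis2023] Lemma 3.1.0.3
(`n^{5/2}`, `h'`, `B = max{|bᵢ|, 3}`). The secondaries disagree only on the power of `n`
(`3/2` vs `5/2`); this def takes the WEAKER `n^{5/2}`, which each printed reading implies.
Users take `(h : yu2007_padicLogForm_logB_rat)`.
[cite: Yu2007, consequence of the Main Theorem, p. 190 (log B form)]
[cite: BerczesEvertseGyory2013, Prop 3.10 (proof)] [cite: Cai2022, Thm 3.3]
[cite: ScoonesThesis2023, Lemma 3.1.0.3] -/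
def yu2007_padicLogForm_logB_rat : Prop :=
  ∀ (κ : Type) [Fintype κ], 2 ≤ Fintype.card κ →
    ∀ (α : κ → ℚ) (b : κ → ℤ) (B : ℝ) (p : ℕ), p.Prime →
      (∀ k, α k ≠ 0) → 3 ≤ B → (∀ k, (|b k| : ℝ) ≤ B) →
      ∏ k, α k ^ b k - 1 ≠ 0 →
      (padicValRat p (∏ k, α k ^ b k - 1) : ℝ) <
        (16 * Real.exp 1) ^ (2 * (Fintype.card κ + 1)) * (Fintype.card κ : ℝ) ^ (5 / 2 : ℝ) *
            Real.log (2 * Fintype.card κ) * Real.log 2 *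
          (p / Real.log p ^ 2) *
          (∏ k, max (logHeight₁ (α k)) (1 / (16 * Real.exp 1 ^ 2))) * Real.log B

/-! ### Primes-only forms (proved from the facts) -/

/-- `h'(q) = h(q) = log q` for a prime `q`: the floor `1/(16e²)` is below `log 2`. [folklore] -/
private theorem max_logHeight₁_prime_floor16 {q : ℕ} (hq : q.Prime) :
    max (logHeight₁ (q : ℚ)) (1 / (16 * Real.exp 1 ^ 2)) = Real.log q := by
  rw [Pasten.logHeight₁_natCast_prime hq]
  refine max_eq_left ?_
  have h2 : Real.log 2 ≤ Real.log q :=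
    Real.log_le_log (by norm_num) (by exact_mod_cast hq.two_le)
  have he : (1 : ℝ) / (16 * Real.exp 1 ^ 2) ≤ 1 / 16 := by
    have h1 : (1 : ℝ) ≤ Real.exp 1 := Real.one_le_exp (by norm_num)
    have h16 : (16 : ℝ) ≤ 16 * Real.exp 1 ^ 2 := by nlinarith
    exact one_div_le_one_div_of_le (by norm_num) h16
  have hlog2 : (1 : ℝ) / 16 ≤ Real.log 2 := by
    have := Real.log_two_gt_d9; linarith
  linarith

/-- `h''(q) = h(q) = log q` for a prime `q`: the floor `1/(8e²)` is below `log 2`. [folklore] -/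
private theorem max_logHeight₁_prime_floor8 {q : ℕ} (hq : q.Prime) :
    max (logHeight₁ (q : ℚ)) (1 / (8 * Real.exp 1 ^ 2)) = Real.log q := by
  rw [Pasten.logHeight₁_natCast_prime hq]
  refine max_eq_left ?_
  have h2 : Real.log 2 ≤ Real.log q :=
    Real.log_le_log (by norm_num) (by exact_mod_cast hq.two_le)
  have he : (1 : ℝ) / (8 * Real.exp 1 ^ 2) ≤ 1 / 8 := by
    have h1 : (1 : ℝ) ≤ Real.exp 1 := Real.one_le_exp (by norm_num)
    have h8 : (8 : ℝ) ≤ 8 * Real.exp 1 ^ 2 := by nlinarith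
    exact one_div_le_one_div_of_le (by norm_num) h8
  have hlog2 : (1 : ℝ) / 8 ≤ Real.log 2 := by
    have := Real.log_two_gt_d9; linarith
  linarith

/-- **Yu 2007 (`log B` form) for rational PRIMES.** From `yu2007_padicLogForm_logB_rat`: for every
prime `p`, every finite set `S` of at least two primes, exponents `e : ℕ → ℤ` with `|e_q| ≤ B`
(`B ≥ 3`) and `∏_{q∈S} q^{e_q} ≠ 1`,
`ord_p(∏_{q∈S} q^{e_q} − 1) < (16e)^{2(#S+1)} (#S)^{5/2} log(2#S) log 2 · p/(log p)² · log B · ∏_{q∈S} log q`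
(`h'(q) = log q`). The prime-text currency of the `abc-stewartyu` routes: the cited statement in the
case `K = ℚ`, `αᵢ` = distinct rational primes, PROVED from the typed `K = ℚ` case.
[cite: Yu2007, consequence of the Main Theorem, p. 190 (log B form), case K = ℚ and αᵢ rational primes] -/
theorem yu2007_padicLogForm_logB_primes (h : yu2007_padicLogForm_logB_rat) :
    ∀ (p : ℕ), p.Prime → ∀ (S : Finset ℕ), (∀ q ∈ S, q.Prime) → 2 ≤ S.card →
    ∀ (e : ℕ → ℤ) (B : ℝ), 3 ≤ B → (∀ q ∈ S, (|e q| : ℝ) ≤ B) →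
    ∏ q ∈ S, (q : ℚ) ^ e q ≠ 1 →
    (padicValRat p (∏ q ∈ S, (q : ℚ) ^ e q - 1) : ℝ) <
      (16 * Real.exp 1) ^ (2 * (S.card + 1)) * (S.card : ℝ) ^ (5 / 2 : ℝ) *
          Real.log (2 * S.card) * Real.log 2 *
        ((p : ℝ) / Real.log p ^ 2) * Real.log B * ∏ q ∈ S, Real.log (q : ℝ) := by
  intro p hp S hS hcard e B hB heB hne1
  classical
  have hcardS : Fintype.card ↥S = S.card := Fintype.card_coe S
  set α : ↥S → ℚ := fun q => ((q.1 : ℕ) : ℚ) with hαdef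
  set b : ↥S → ℤ := fun q => e q.1 with hbdef
  have hα : ∀ i, α i ≠ 0 := fun i => by
    simp only [hαdef]; exact_mod_cast (hS i.1 i.2).ne_zero
  set X : ℚ := ∏ q ∈ S, (q : ℚ) ^ e q with hXdef
  have hprod : ∏ i, α i ^ b i = X := by
    rw [hXdef, ← Finset.prod_coe_sort S (fun q : ℕ => (q : ℚ) ^ e q)]
  have hΛ : ∏ i, α i ^ b i - 1 ≠ 0 := by rw [hprod]; exact sub_ne_zero.mpr hne1
  have hbB : ∀ i, (|b i| : ℝ) ≤ B := fun i => heB i.1 i.2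
  have h0 := h (↥S) (by rw [hcardS]; exact hcard) α b B p hp hα hB hbB hΛ
  rw [hprod, hcardS] at h0
  have hH : ∏ i, max (logHeight₁ (α i)) (1 / (16 * Real.exp 1 ^ 2)) =
      ∏ q ∈ S, Real.log (q : ℝ) := by
    rw [← Finset.prod_coe_sort S (fun q : ℕ => Real.log (q : ℝ))]
    refine Finset.prod_congr rfl fun i _ => ?_
    exact max_logHeight₁_prime_floor16 (hS i.1 i.2)
  rw [hH] at h0
  have hfinal :
      (16 * Real.exp 1) ^ (2 * (S.card + 1)) * (S.card : ℝ) ^ (5 / 2 : ℝ) *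
            Real.log (2 * S.card) * Real.log 2 *
          ((p : ℝ) / Real.log p ^ 2) * (∏ q ∈ S, Real.log (q : ℝ)) * Real.log B =
      (16 * Real.exp 1) ^ (2 * (S.card + 1)) * (S.card : ℝ) ^ (5 / 2 : ℝ) *
            Real.log (2 * S.card) * Real.log 2 *
          ((p : ℝ) / Real.log p ^ 2) * Real.log B * ∏ q ∈ S, Real.log (q : ℝ) := by ring
  rw [hfinal] at h0
  exact h0

/-- **Yu 2007 (`℘`-adic-units form) for rational PRIMES.** From `yu2007_padicLogForm_units_rat`:
for a prime `p`, a finite set `S` of at least two primes with `p ∉ S` (so each `q ∈ S` is a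
`p`-adic unit; distinct primes are multiplicatively independent), exponents `e : ℕ → ℤ`, a
distinguished `q₀ ∈ S` with `e_{q₀} ≠ 0` and `ord_p e_{q₀} ≤ ord_p e_q` whenever `e_q ≠ 0`,
reals `B ≥ max |e_q|`, `B ≥ Bₙ ≥ |e_{q₀}|`, `0 < δ ≤ ½`, and `∏ q^{e_q} ≠ 1`:
`ord_p(∏ q^{e_q} − 1) < c aⁿ n^{3/2} log(2n) log 2 · p/(log p)² ·
  max{ (∏_{q∈S} log q) · log((Bₙ/δ) · 2e^{(n+1)(6n+5)} log 2 · p^{n+1} · ∏_{q∈S∖{q₀}} log q),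
       δB/(Bₙ 2^{n+1} log 2 (log 3)³) }`, `n = #S`, `(c, a)` as in the fact
(`h(q) = log q`, `h''(q₀) = log q₀`): the cited statement in the case `K = ℚ`, `αᵢ` = distinct rational
primes, PROVED from the typed `K = ℚ` case.
[cite: GyoryYu2006, Proposition 7 (p. 23), case K = ℚ and αᵢ rational primes] -/
theorem yu2007_padicLogForm_units_primes (h : yu2007_padicLogForm_units_rat) :
    ∀ (p : ℕ), p.Prime → ∀ (S : Finset ℕ), (∀ q ∈ S, q.Prime) → p ∉ S → 2 ≤ S.card →
    ∀ (e : ℕ → ℤ) (q₀ : ℕ), q₀ ∈ S → e q₀ ≠ 0 →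
    (∀ q ∈ S, e q ≠ 0 → padicValInt p (e q₀) ≤ padicValInt p (e q)) →
    ∀ (B Bn δ : ℝ), (∀ q ∈ S, (|e q| : ℝ) ≤ B) → Bn ≤ B → (|e q₀| : ℝ) ≤ Bn →
    0 < δ → δ ≤ 1 / 2 →
    ∏ q ∈ S, (q : ℚ) ^ e q ≠ 1 →
    (padicValRat p (∏ q ∈ S, (q : ℚ) ^ e q - 1) : ℝ) <
      (if p = 2 then (292 : ℝ) else 1692) *
          (if p = 2 then 128 * Real.exp 1 ^ 2 else 48 * Real.exp 1 ^ 2) ^ S.card *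
          (S.card : ℝ) ^ (3 / 2 : ℝ) * Real.log (2 * S.card) * Real.log 2 *
        ((p : ℝ) / Real.log p ^ 2) *
        max ((∏ q ∈ S, Real.log (q : ℝ)) *
              Real.log (Bn / δ * (2 * Real.exp 1 ^ ((S.card + 1) * (6 * S.card + 5)) *
                Real.log 2) * (p : ℝ) ^ (S.card + 1) * ∏ q ∈ S.erase q₀, Real.log (q : ℝ)))
          (δ * B / (Bn * (2 ^ (S.card + 1) * Real.log 2 * Real.log 3 ^ 3))) := by
  intro p hp S hS hpS hcard e q₀ hq₀ he₀ hord B Bn δ heB hBn hBn' hδ hδ' hne1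
  classical
  have hcardS : Fintype.card ↥S = S.card := Fintype.card_coe S
  set α : ↥S → ℚ := fun q => ((q.1 : ℕ) : ℚ) with hαdef
  set b : ↥S → ℤ := fun q => e q.1 with hbdef
  set k₀ : ↥S := ⟨q₀, hq₀⟩ with hk₀def
  -- the generators are `p`-adic units
  have hα : ∀ i, α i ≠ 0 ∧ padicValRat p (α i) = 0 := fun i =>
    ⟨by simp only [hαdef]; exact_mod_cast (hS i.1 i.2).ne_zero,
      Literature.Barriers.ABC.StewartTijdemanGeneric.padicValRat_natCast_prime_of_ne hp (hS i.1 i.2)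
        (fun hq => hpS (hq ▸ i.2))⟩
  -- distinct primes are multiplicatively independent (all of them, a fortiori those `≠ q₀`)
  have hind : ∀ μ : ↥S → ℤ, μ k₀ = 0 → ∏ k, α k ^ μ k = 1 → μ = 0 := by
    intro μ _ hμ
    set φ : Fin S.card ≃ ↥S := S.equivFin.symm with hφ
    set q : Fin S.card → ℕ := fun i => ((φ i : ↥S) : ℕ) with hqdef
    have hqP : ∀ i, (q i).Prime := fun i => hS _ (φ i).2
    have hinj : Function.Injective q := fun i j hij => φ.injective (Subtype.ext hij)
    have hre : ∏ i, ((q i : ℕ) : ℚ) ^ μ (φ i) = ∏ k, α k ^ μ k :=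
      Fintype.prod_equiv φ (fun i => ((q i : ℕ) : ℚ) ^ μ (φ i)) (fun k => α k ^ μ k)
        (fun i => rfl)
    have h1 : ∏ i, ((q i : ℕ) : ℚ) ^ (μ ∘ φ) i = 1 := by
      simpa [Function.comp] using hre.trans hμ
    have hz := Literature.Barriers.ABC.StewartTijdemanGeneric.prime_family_zpow_eq_one hqP hinj h1
    funext k
    have := congr_fun hz (φ.symm k)
    simpa [Function.comp] using this
  set X : ℚ := ∏ q ∈ S, (q : ℚ) ^ e q with hXdef
  have hprod : ∏ i, α i ^ b i = X := by
    rw [hXdef, ← Finset.prod_coe_sort S (fun q : ℕ => (q : ℚ) ^ e q)]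
  have hΛ : ∏ i, α i ^ b i - 1 ≠ 0 := by rw [hprod]; exact sub_ne_zero.mpr hne1
  have hb₀ : b k₀ ≠ 0 := he₀
  have hordb : ∀ k, b k ≠ 0 → padicValInt p (b k₀) ≤ padicValInt p (b k) :=
    fun k hk => hord k.1 k.2 hk
  have hbB : ∀ i, (|b i| : ℝ) ≤ B := fun i => heB i.1 i.2
  have hbn : (|b k₀| : ℝ) ≤ Bn := hBn'
  have h0 := h (↥S) (by rw [hcardS]; exact hcard) α b k₀ B Bn δ p hp hα hind hb₀ hordb hbB hBn
    hbn hΛ hδ hδ'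
  rw [hprod, hcardS] at h0
  -- heights: `h(q) = log q`, `h''(q₀) = log q₀`
  have hHerase : ∏ k ∈ univ.erase k₀, logHeight₁ (α k) = ∏ q ∈ S.erase q₀, Real.log (q : ℝ) := by
    have h1 : ∏ k ∈ univ.erase k₀, logHeight₁ (α k) =
        ∏ k ∈ univ.erase k₀, Real.log (((k : ↥S) : ℕ) : ℝ) :=
      Finset.prod_congr rfl fun k _ => Pasten.logHeight₁_natCast_prime (hS k.1 k.2)
    rw [h1]
    have h2 : ∏ k ∈ (univ : Finset ↥S), Real.log (((k : ↥S) : ℕ) : ℝ) =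
        ∏ q ∈ S, Real.log (q : ℝ) := by
      rw [← Finset.prod_coe_sort S (fun q : ℕ => Real.log (q : ℝ))]
    have h3 := Finset.mul_prod_erase (univ : Finset ↥S) (fun k : ↥S => Real.log ((k : ℕ) : ℝ))
      (Finset.mem_univ k₀)
    have h4 := Finset.mul_prod_erase S (fun q : ℕ => Real.log (q : ℝ)) hq₀
    have hq₀pos : 0 < Real.log (q₀ : ℝ) :=
      Real.log_pos (by exact_mod_cast (hS q₀ hq₀).one_lt)
    have h5 : Real.log ((k₀ : ℕ) : ℝ) = Real.log (q₀ : ℝ) := rfl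
    rw [h5] at h3
    rw [h2] at h3
    exact mul_left_cancel₀ hq₀pos.ne' (h3.trans h4.symm)
  have hH0 : max (logHeight₁ (α k₀)) (1 / (8 * Real.exp 1 ^ 2)) = Real.log (q₀ : ℝ) :=
    max_logHeight₁_prime_floor8 (hS q₀ hq₀)
  have hHfull : (∏ q ∈ S.erase q₀, Real.log (q : ℝ)) * Real.log (q₀ : ℝ) =
      ∏ q ∈ S, Real.log (q : ℝ) := by
    rw [mul_comm]; exact Finset.mul_prod_erase S (fun q : ℕ => Real.log (q : ℝ)) hq₀
  rw [hHerase, hH0, hHfull] at h0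
  exact h0

end Literature.NumberTheory.DiophantineGeometry.Dioph

end
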